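import Summits.QuantumFields.BalabanUV.Beta.EriceRemainderEnclosureHistoryAutonomyComparisonAgeCompositionOldPairLetters

/-!
# EriceRemainderEnclosureHistoryAutonomyComparisonAgeCompositionOldPairCap — (E99b) route (N), first order: THE OLD-PAIR CAP.  Along every box solution
# of an isotone dominated memory with floor, two near old ages `56 ≤ j < k ≤ 2j` carry together at most `x_j(m) + x_k(m) ≤ 0.617` at every pin — ONE
# old age's worth (single-age cap `0.6142`, (E94b) `load_le_of_sq`; truth `0.58–0.59` for the pair against `0.58` for one age, gen 86 kit j340398),
# not two.  The certificate is the dichotomy (E99a) `old_pair_box` on SIXTEEN boxes of the span `k∕j ∈ [1, 2]` (rational constants `c_a, c_b` of the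
# stretch and far-window rays valid on the box for every `j ≥ 56`, one rational threshold witness `sh`; exact `Fraction` verification in
# `HOME/b2b-balaban-beta-d4-p2/g87/numerics/oldpair_cert.py` → `oldpair_cert.json`; every side condition re-checked here by `norm_num`), fed by (E99a)
# `old_pair_letters` with the own-window constant `c_K = c_J = 0.8104` (`0.8104²(3k+1) ≤ 2k` from `k ≥ 23`; `2·0.8104·0.617 ≥ 1`).
# **`near_pair_load_le`** packages the level form used by the cluster cascade: for `56 ≤ lo ≤ hi ≤ 2lo` the cluster `{lo, hi}` (one age if `lo = hi`)
# has `Σ_{k ∈ {lo,hi}} x_k(m) ≤ 0.617` — what the ×61 cascade of (E95c)∕(E97c) tolerates from an older level at `κ = 1∕5`; the sequel (E99c) feeds it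

Cell `pub-balaban`, β-function sub-cell, BINDER row D4 «RemainderConst leaves for Bałaban's split» (`HOME/BINDER-OWNERS.md`; owner lineage `b2b-balaban-beta-an4`;
this file by co-owner #2 lineage `b2b-balaban-beta-d4-p2`, generation 87), β-FLOW TEAM duty (1), FREEZE (0) honoured (def-free; nothing restated).

HONEST FRAMING (page 1, verbatim and binding).  *"Discharging BetaPertH makes Bałaban's UV stability UNCONDITIONAL — a real constructive-QFT result; it is
NOT the continuum limit and NOT the Clay problem."*  THIS FILE DISCHARGES NOTHING OF THE KIND.  Elementary real algebra ∕ real analysis about ABSTRACT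
functionals on a box ]0,γ]^ℕ with displayed floors, profiles and signs, and the FIRST-ORDER renewal objects of route (N) built from them — hypotheses of a
census, not facts; the form, signs, ages and moments of Bałaban's (1.22) limit functional are NOT PRINTED ([I] p. 298; GAPS G-t4-U2-1∕-2) and NOT asserted.
Row D4 class UNCHANGED (critical-path width 0; instance 0∕1; D4 DISCHARGE NO DATE).  HONEST DEPENDENCY: continuum YM on T⁴ ⇐ BetaPertH ∧ nine spine
estimates (0/9 proved); BetaPertH ⇐ (D1) ∧ (D4) ∧ CAP+tail; G-an2-4 gates asym, D1 and NE2/3/4.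

THE POINT (README `HOME/b2b-balaban-beta-d4-p2/g87/README.md` §2–§3).  The boxes `[F₁, F₂]: (c_a, c_b, sh)` — [1, 511/500]: (9901/10000, 407/500, 10087/10000); [511/500, 1051/1000]: (1229/1250, 817/1000, 10211/10000); [1051/1000, 109/100]: (487/500, 513/625, 5187/5000); [109/100, 57/50]: (9627/10000, 516/625, 10579/10000); [57/50, 1203/1000]: (9489/10000, 4157/5000, 10829/10000); [1203/1000, 32/25]: (9329/10000, 4191/5000, 89/80); [32/25, 1371/1000]: (9149/10000, 4229/5000, 5731/5000); [1371/1000, 1473/1000]: (112/125, 8539/10000, 739/625); [1473/1000, 79/50]: (4387/5000, 431/500, 3047/2500); [79/50, 1683/1000]: (1721/2000, 1087/1250, 3131/2500); [1683/1000, 222/125]: (423/500, 4381/5000, 12817/10000); [222/125, 1853/1000]: (4173/5000, 551/625, 3263/2500); [1853/1000, 1913/1000]: (413/500, 8857/10000, 1323/1000); [1913/1000, 1957/1000]: (8199/10000, 8887/10000, 13359/10000); [1957/1000, 497/250]: (8157/10000, 2227/2500, 13449/10000); [497/250, 2]: (407/500, 4461/5000, 13479/10000).  On each: `c_a²((1+F₂)·56+1)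 ≤ 112`,
`c_a²(1+F₂) ≤ 2` (so `c_a²(j+k+1) ≤ 2j` for `j ≥ 56`, `k ≤ F₂j`), `c_b²(112F₁+57) ≤ 112F₁`, `c_b² ≤ 1` (so `c_b²(2k+j+1) ≤ 2k` for `k ≥ F₁j`), `F₂ ≤ 2c_b·0.617·sh²`,
`c_b ≤ c_a·sh`, `1 ≤ 0.617·(4c_ac_b·0.617·(1 − 1∕F₁) + 4c_b²·0.617∕(F₁·sh))`.  Uses (E99a) `old_pair_letters`∕`old_pair_box`, (E94b) `load_le_of_sq` BY NAME.
NOT CLAIMED: `k > 2j`; `j < 56`; anything printed — NOT B12 Thm 2, NOT BetaPertH, NOT continuum, NOT Clay.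

WHAT IS PROVED ([folklore]; 0 `def`, 0 sorry).  **`old_pair_load_le_of_box`** (one box, constants displayed), **`old_pair_load_le`** (`56 ≤ j < k ≤ 2j`:
`x_j(m) + x_k(m) ≤ 0.617`), **`near_pair_load_le`** (`Σ_{k∈{lo,hi}} x_k(m) ≤ 0.617` for `56 ≤ lo ≤ hi ≤ 2lo`).
-/
noncomputable section
open Finset

namespace Summit.QuantumFields.BalabanUV.Beta.EriceRemainderEnclosureHistoryAutonomyComparisonAgeCompositionOldPairCap

open Literature.MathematicalPhysics.QuantumFieldTheory.Balaban1983to89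
open Literature.MathematicalPhysics.QuantumFieldTheory.Balaban1983to89.T4BetaStationary
open Literature.MathematicalPhysics.QuantumFieldTheory.Balaban1983to89.T4BetaFlowWellPosed
open Summit.QuantumFields.BalabanUV.Beta.EriceRemainderEnclosureHistoryAutonomyComparisonAgeCompositionYoungPairMoment (load_le_of_sq)
open Summit.QuantumFields.BalabanUV.Beta.EriceRemainderEnclosureHistoryAutonomyComparisonAgeCompositionOldPairLetters (old_pair_letters old_pair_box)

variable {B : (ℕ → ℝ) → ℝ} {γ b gIR : ℝ} {L : ℕ → ℝ} {K : ℕ} {h : ℕ → ℝ}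

/-- **ONE BOX OF THE SPAN.**  Along every box solution of an isotone dominated memory with floor (`L ≥ 0`), ages `56 ≤ j < k < K` with `F₁j ≤ k ≤ F₂j`
and rational box constants `c_a, c_b, sh` satisfying the seven displayed side conditions: `x_j(m) + x_k(m) ≤ 0.617` — (E99a) `old_pair_letters` with
`c_K = c_J = 0.8104` and the box's `c_a, c_b`, then (E99a) `old_pair_box`. [folklore] -/
theorem old_pair_load_le_of_box (hmono : ∀ u v : ℕ → ℝ, SeqBox γ u → SeqBox γ v → (∀ j, u j ≤ v j) → B u ≤ B v)
    (hL : ∀ k, 0 ≤ L k) (hb : 0 < b) (hlo : ∀ u, SeqBox γ u → b ≤ B u) (hdom : ∀ u, SeqBox γ u → ∑ k ∈ range K, L k * u k ≤ B u)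
    (hh : SeqBox γ h) (hf : MemFlow B gIR h) {j k : ℕ} (hj : 56 ≤ j) (hjk : j < k) (hkK : k < K) {F₁ F₂ ca cb sh : ℝ}
    (hk1 : F₁ * j ≤ k) (hk2 : (k : ℝ) ≤ F₂ * j)
    (hbox : 1 ≤ F₁ ∧ 0 ≤ ca ∧ 0 ≤ cb ∧ 0 < sh ∧ ca ^ 2 * ((1 + F₂) * 56 + 1) ≤ 112 ∧ ca ^ 2 * (1 + F₂) ≤ 2
      ∧ cb ^ 2 * (112 * F₁ + 57) ≤ 112 * F₁ ∧ cb ^ 2 ≤ 1 ∧ F₂ ≤ 2 * cb * (617 / 1000) * sh ^ 2 ∧ cb ≤ ca * sh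
      ∧ 1 ≤ (617 / 1000 : ℝ) * (4 * ca * cb * (617 / 1000) * (1 - 1 / F₁) + 4 * cb ^ 2 * (617 / 1000) / (F₁ * sh))) (m : ℕ) :
    (j : ℝ) * (L j * h (m + j) ^ 3 / 2) + (k : ℝ) * (L k * h (m + k) ^ 3 / 2) ≤ 617 / 1000 := by
  obtain ⟨hF1, hca0, hcb0, hsh, hc1a, hc1b, hc2a, hc2b, hc3, hc4, hc5⟩ := hbox
  have hpos : ∀ n, 0 < h n := fun n => (hh n).1
  have hjr : (56 : ℝ) ≤ j := by exact_mod_cast hj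
  have hjkr : (j : ℝ) + 1 ≤ k := by exact_mod_cast hjk
  have hjpos : (0 : ℝ) < j := by linarith
  -- the own-window constant 0.8104 from age 23 on, and the box's stretch ∕ far-window constants
  have hcK : ((1013 : ℝ) / 1250) ^ 2 * (3 * (k : ℝ) + 1) ≤ 2 * k := by nlinarith
  have hcJ : ((1013 : ℝ) / 1250) ^ 2 * (3 * (j : ℝ) + 1) ≤ 2 * j := by nlinarith
  have hca : ca ^ 2 * ((j : ℝ) + k + 1) ≤ 2 * j := by
    have h1 : ca ^ 2 * ((j : ℝ) + k + 1) ≤ ca ^ 2 * ((1 + F₂) * j + 1) := mul_le_mul_of_nonneg_left (by linarith) (sq_nonneg ca)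
    have h2 := mul_le_mul_of_nonneg_left hjr (sub_nonneg.2 hc1b)
    nlinarith
  have hcb : cb ^ 2 * (2 * (k : ℝ) + j + 1) ≤ 2 * k := by
    have hE : 0 ≤ 2 * F₁ - 2 * cb ^ 2 * F₁ - cb ^ 2 := by nlinarith [sq_nonneg cb]
    have h1 := mul_le_mul_of_nonneg_left hk1 (by nlinarith : (0 : ℝ) ≤ 2 - 2 * cb ^ 2)
    have h2 := mul_le_mul_of_nonneg_left hjr hE
    nlinarith
  obtain ⟨hσ1, -, hK, hJ⟩ := old_pair_letters hmono hL hb hlo hdom hh hf (by omega : 1 ≤ j) hjk hkK hcK hcJ hca hcb m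
  have hx : 0 ≤ (j : ℝ) * (L j * h (m + j) ^ 3 / 2) := by have := hL j; have := hpos (m + j); positivity
  have hy : 0 ≤ (k : ℝ) * (L k * h (m + k) ^ 3 / 2) := by have := hL k; have := hpos (m + k); positivity
  exact old_pair_box hx hy (lt_of_lt_of_le one_pos hσ1) hjpos hk1 hk2 hF1 (by norm_num) hca0 hcb0 hsh hK hJ
    (by norm_num) (by norm_num) hc3 hc4 hc5

/-- **THE OLD-PAIR CAP**: along every box solution of an isotone dominated memory with floor (`L ≥ 0`), for ages `56 ≤ j < k ≤ 2j` (`k < K`),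
`x_j(m) + x_k(m) = j·L_jh_{m+j}³∕2 + k·L_kh_{m+k}³∕2 ≤ 0.617` at every pin (sixteen boxes of `k∕j ∈ [1,2]`, `old_pair_load_le_of_box`). [folklore] -/
theorem old_pair_load_le (hmono : ∀ u v : ℕ → ℝ, SeqBox γ u → SeqBox γ v → (∀ j, u j ≤ v j) → B u ≤ B v)
    (hL : ∀ k, 0 ≤ L k) (hb : 0 < b) (hlo : ∀ u, SeqBox γ u → b ≤ B u) (hdom : ∀ u, SeqBox γ u → ∑ k ∈ range K, L k * u k ≤ B u)
    (hh : SeqBox γ h) (hf : MemFlow B gIR h) {j k : ℕ} (hj : 56 ≤ j) (hjk : j < k) (hk2 : k ≤ 2 * j) (hkK : k < K) (m : ℕ) :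
    (j : ℝ) * (L j * h (m + j) ^ 3 / 2) + (k : ℝ) * (L k * h (m + k) ^ 3 / 2) ≤ 617 / 1000 := by
  have hk2r : (k : ℝ) ≤ 2 * j := by exact_mod_cast hk2
  have hk1r : (1 : ℝ) * j ≤ k := by rw [one_mul]; exact_mod_cast hjk.le
  rcases le_or_gt (k : ℝ) (511 / 500 * j) with h1 | h1
  · exact old_pair_load_le_of_box hmono hL hb hlo hdom hh hf hj hjk hkK hk1r h1
      (ca := 9901 / 10000) (cb := 407 / 500) (sh := 10087 / 10000) (by norm_num) m
  rcases le_or_gt (k : ℝ) (1051 / 1000 * j) with h2 | h2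
  · exact old_pair_load_le_of_box hmono hL hb hlo hdom hh hf hj hjk hkK h1.le h2
      (ca := 1229 / 1250) (cb := 817 / 1000) (sh := 10211 / 10000) (by norm_num) m
  rcases le_or_gt (k : ℝ) (109 / 100 * j) with h3 | h3
  · exact old_pair_load_le_of_box hmono hL hb hlo hdom hh hf hj hjk hkK h2.le h3
      (ca := 487 / 500) (cb := 513 / 625) (sh := 5187 / 5000) (by norm_num) m
  rcases le_or_gt (k : ℝ) (57 / 50 * j) with h4 | h4
  · exact old_pair_load_le_of_box hmono hL hb hlo hdom hh hf hj hjk hkK h3.le h4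
      (ca := 9627 / 10000) (cb := 516 / 625) (sh := 10579 / 10000) (by norm_num) m
  rcases le_or_gt (k : ℝ) (1203 / 1000 * j) with h5 | h5
  · exact old_pair_load_le_of_box hmono hL hb hlo hdom hh hf hj hjk hkK h4.le h5
      (ca := 9489 / 10000) (cb := 4157 / 5000) (sh := 10829 / 10000) (by norm_num) m
  rcases le_or_gt (k : ℝ) (32 / 25 * j) with h6 | h6
  · exact old_pair_load_le_of_box hmono hL hb hlo hdom hh hf hj hjk hkK h5.le h6
      (ca := 9329 / 10000) (cb := 4191 / 5000) (sh := 89 / 80) (by norm_num) m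
  rcases le_or_gt (k : ℝ) (1371 / 1000 * j) with h7 | h7
  · exact old_pair_load_le_of_box hmono hL hb hlo hdom hh hf hj hjk hkK h6.le h7
      (ca := 9149 / 10000) (cb := 4229 / 5000) (sh := 5731 / 5000) (by norm_num) m
  rcases le_or_gt (k : ℝ) (1473 / 1000 * j) with h8 | h8
  · exact old_pair_load_le_of_box hmono hL hb hlo hdom hh hf hj hjk hkK h7.le h8
      (ca := 112 / 125) (cb := 8539 / 10000) (sh := 739 / 625) (by norm_num) m
  rcases le_or_gt (k : ℝ) (79 / 50 * j) with h9 | h9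
  · exact old_pair_load_le_of_box hmono hL hb hlo hdom hh hf hj hjk hkK h8.le h9
      (ca := 4387 / 5000) (cb := 431 / 500) (sh := 3047 / 2500) (by norm_num) m
  rcases le_or_gt (k : ℝ) (1683 / 1000 * j) with h10 | h10
  · exact old_pair_load_le_of_box hmono hL hb hlo hdom hh hf hj hjk hkK h9.le h10
      (ca := 1721 / 2000) (cb := 1087 / 1250) (sh := 3131 / 2500) (by norm_num) m
  rcases le_or_gt (k : ℝ) (222 / 125 * j) with h11 | h11
  · exact old_pair_load_le_of_box hmono hL hb hlo hdom hh hf hj hjk hkK h10.le h11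
      (ca := 423 / 500) (cb := 4381 / 5000) (sh := 12817 / 10000) (by norm_num) m
  rcases le_or_gt (k : ℝ) (1853 / 1000 * j) with h12 | h12
  · exact old_pair_load_le_of_box hmono hL hb hlo hdom hh hf hj hjk hkK h11.le h12
      (ca := 4173 / 5000) (cb := 551 / 625) (sh := 3263 / 2500) (by norm_num) m
  rcases le_or_gt (k : ℝ) (1913 / 1000 * j) with h13 | h13
  · exact old_pair_load_le_of_box hmono hL hb hlo hdom hh hf hj hjk hkK h12.le h13
      (ca := 413 / 500) (cb := 8857 / 10000) (sh := 1323 / 1000) (by norm_num) m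
  rcases le_or_gt (k : ℝ) (1957 / 1000 * j) with h14 | h14
  · exact old_pair_load_le_of_box hmono hL hb hlo hdom hh hf hj hjk hkK h13.le h14
      (ca := 8199 / 10000) (cb := 8887 / 10000) (sh := 13359 / 10000) (by norm_num) m
  rcases le_or_gt (k : ℝ) (497 / 250 * j) with h15 | h15
  · exact old_pair_load_le_of_box hmono hL hb hlo hdom hh hf hj hjk hkK h14.le h15
      (ca := 8157 / 10000) (cb := 2227 / 2500) (sh := 13449 / 10000) (by norm_num) m
  · exact old_pair_load_le_of_box hmono hL hb hlo hdom hh hf hj hjk hkK h15.le hk2r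
      (ca := 407 / 500) (cb := 4461 / 5000) (sh := 13479 / 10000) (by norm_num) m

/-- **THE NEAR-PAIR LEVEL.**  For `56 ≤ lo ≤ hi ≤ 2lo` (`hi < K`) the cluster `{lo, hi}` carries `Σ_{k ∈ {lo,hi}} x_k(m) ≤ 0.617` at every pin: one age
(`lo = hi`, (E94b) `load_le_of_sq`: `8k·0.617² ≥ 3k+1` from `k ≥ 22`) or a near old pair (`old_pair_load_le`). [folklore] -/
theorem near_pair_load_le (hmono : ∀ u v : ℕ → ℝ, SeqBox γ u → SeqBox γ v → (∀ j, u j ≤ v j) → B u ≤ B v)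
    (hL : ∀ k, 0 ≤ L k) (hb : 0 < b) (hlo : ∀ u, SeqBox γ u → b ≤ B u) (hdom : ∀ u, SeqBox γ u → ∑ k ∈ range K, L k * u k ≤ B u)
    (hh : SeqBox γ h) (hf : MemFlow B gIR h) {lo hi : ℕ} (hlo56 : 56 ≤ lo) (hlohi : lo ≤ hi) (hhi : hi ≤ 2 * lo) (hhiK : hi < K) (m : ℕ) :
    ∑ k ∈ ({lo, hi} : Finset ℕ), (k : ℝ) * (L k * h (m + k) ^ 3 / 2) ≤ 617 / 1000 := by
  rcases hlohi.eq_or_lt with heq | hlt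
  · subst heq
    rw [insert_eq_of_mem (mem_singleton_self lo), sum_singleton]
    have hlor : (56 : ℝ) ≤ lo := by exact_mod_cast hlo56
    exact load_le_of_sq hmono hL hb hlo hdom hh hf (by omega) hhiK (so := 617 / 1000) (by norm_num) (by nlinarith) m
  · rw [sum_pair (ne_of_lt hlt)]
    exact old_pair_load_le hmono hL hb hlo hdom hh hf hlo56 hlt hhi hhiK m

end Summit.QuantumFields.BalabanUV.Beta.EriceRemainderEnclosureHistoryAutonomyComparisonAgeCompositionOldPairCap
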